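import Summits.RiemannHypothesis.RiemannHypothesis.Theorems.Splittings.BombieriTruncMassAware
import Literature.NumberTheory.DiophantineGeometry.NamedHypotheses
import Literature.NumberTheory.LFunctions.RHWave0
import Literature.NumberTheory.LFunctions.WeilZeroSum
import Literature.NumberTheory.LFunctions.VinogradovKorobovFarZeros
import HarnessLib

/-!
# Splittings — x-wuc GEN-8 (xiv-f) 1/5: OFF-LINE SCREENING ABOVE A HEIGHT — rows X-7 / X-7₁ at all levels and at a FIXED level `c₀`

Cell rh-split, seat rh-split-x-wuc g8 (brief sha16 f79c5f09d8bcb036), card `run/shared/lean/pub/rh-split/cards/SPLIT-x-wuc.md` §14.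
CARVE NOTE (lane (xiv-f), lead RULING #113): part 1/5 of the VERBATIM carve of §G8.4–§G8.12 of the FROZEN scratch
`HOME/rh-split-x-wuc/SplitXWucG8.lean` sha16 72896d9b60505e56 (rider 5 FINAL, x-wuc g8 DONE; ref g6 REPLAY PASS 13:08:54Z),
source lines l.382–558, by rh-split-typer-3 g0; §G8.1–§G8.3 are the landed `Splittings/BombieriTruncMassAware.lean` (p531810), whose
namespace `…Splittings.BombieriTruncMassAware` every part RE-OPENS (FQNs do not move); the scratch's `#print axioms` guards are not
carried (referee `--axioms` replay instead); untagged parameterised `def … : Prop` hypotheses (`LocBand`, `HelperBand`, `OrdinateBand`)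
are kept VERBATIM (typer's discretion per HANDOFF-g8: predicates / discharged hypotheses, not Literature facts).

* G8.4 `OffLineScreenedAbove T₀` (`@[conjecture] def`, the paper theorem of card §14b displayed as a HYPOTHESIS), `exists_offLine_above`,
  rows **X-7** `rh_iff_rhUpTo_and_boundedAway : OffLineScreenedAbove T₀ → (RH ↔ RH(T₀) ∧ B′([−1,1]))` and **X-7/PT**
  `boundedAway_iff_rh_of_plattTrudgian`, `synthesisScreening_of_screenedAbove`.
* G8.4b FIXED-LEVEL variants (card §14h; note «0 < c₀» is part of the row hypotheses): `TruncNegEigenvalueBoundedAwayAt E c₀` = `B′_{c₀}(E)`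
  (`@[conjecture] def`), `boundedAway_of_boundedAwayAt`, `boundedAwayAt_of_rh`, `OffLineScreenedAboveAt T₀ c₀` (`@[conjecture] def`), row **X-7₁**
  `rh_iff_rhUpTo_and_boundedAwayAt` and X-7₁/PT.
LABEL (referee g6): X-7 rows = CONDITIONAL bookkeeping (the screening hypothesis rests on the ONE ζ-free residual conjecture
`MassAwareSampling`, part 2); RH-equivalence typing, certifies nothing about RH.
HONEST LABEL: «SPLITTING SEARCH over kernel-typed RH-EQUIVALENCES; a splitting A ∧ B ⟹ RH is CONDITIONAL bookkeeping
unless A and B are both proved; nothing here bears on the truth of RH.»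
-/

set_option linter.dupNamespace false

noncomputable section

open scoped Classical ComplexConjugate
open Set Filter Topology Complex MeasureTheory

namespace Summit.RiemannHypothesis.RiemannHypothesis.Theorems.Splittings.BombieriTruncMassAware

open Literature.NumberTheory.LFunctions Literature.NumberTheory.LFunctions.Bombieri2000
open Summit.RiemannHypothesis.RiemannHypothesis.Theses.RuelleBand
open Summit.RiemannHypothesis.RiemannHypothesis.Theorems.Splittings.BombieriTruncEigen
open Summit.RiemannHypothesis.RiemannHypothesis.Theorems.Splittings.BombieriFozNoDep
open Summit.RiemannHypothesis.RiemannHypothesis.Theorems.Splittings.BombieriTruncGram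
open Summit.RiemannHypothesis.RiemannHypothesis.Theorems.Splittings.BombieriTruncPairing
open Summit.RiemannHypothesis.RiemannHypothesis.Theorems.Splittings.BombieriTruncScreening
open Summit.RiemannHypothesis.RiemannHypothesis.Theorems.Splittings.BombieriTruncBandGap
open Summit.RiemannHypothesis.RiemannHypothesis.Theorems.Splittings.BombieriTruncMultiplicity
open Summit.RiemannHypothesis.RiemannHypothesis.Theorems.Splittings.BombieriTruncEventualStrip
open Summit.RiemannHypothesis.RiemannHypothesis.Theorems.Splittings.BombieriTruncExactness
open Summit.RiemannHypothesis.RiemannHypothesis.Theorems.Splittings.BombieriTruncClump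
open Summit.RiemannHypothesis.RiemannHypothesis.Theorems.Splittings.BombieriTruncOffLineSparse
open Summit.RiemannHypothesis.RiemannHypothesis.Theorems.Splittings.BombieriTruncSynthesis
open Summit.RiemannHypothesis.RiemannHypothesis.Theorems.Splittings.BombieriTruncSynthesisScreening
open Summit.RiemannHypothesis.RiemannHypothesis.Theorems.Splittings.BombieriTruncSynthesisRows

variable {N : ℕ}

/-! ### G8.4 OFF-LINE SCREENING ABOVE A HEIGHT, the typed sampling lemma, and row X-7 -/

open Literature.NumberTheory.DiophantineGeometry (RiemannHypothesisUpTo)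

/-- **OFF-LINE SCREENING ABOVE HEIGHT `T₀`** (the paper theorem of card §14b displayed as a HYPOTHESIS; its proof in words:
T8a + Riemann–von Mangoldt + the explicit `S(T)` bound + the mass-aware sampling lemma `MassAwareSampling δ θ` with `θ > C₁(T₀)·Φ(½)/2`).
Every nontrivial zero RIGHT of the critical line and ABOVE height `T₀` is SCREENED at every level: for every `c > 0` all deep truncations
`𝒦_{[−1,1]}(Γ_N)` have a real eigenvalue in `(−c, 0)`.  (Vacuously true under RH; the content is «¬RH above `T₀` ⟹ ¬B′([−1,1])».) [new] -/
@[conjecture] def OffLineScreenedAbove (T₀ : ℝ) : Prop :=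
  ∀ ρ ∈ ZetaZeros.riemannZetaNontrivialZeros, 1 / 2 < ρ.re → T₀ < ρ.im →
    ∀ c : ℝ, 0 < c → ∃ N₀ : ℕ, ∀ N : ℕ, N₀ ≤ N →
      ∃ μ ∈ (truncKMat (Icc (-1 : ℝ) 1) N).charpoly.roots, μ.im = 0 ∧ -c < μ.re ∧ μ.re < 0

/-- Screening above a height is monotone in the height. -/
theorem offLineScreenedAbove_mono {T₀ T₁ : ℝ} (hT : T₀ ≤ T₁) (h : OffLineScreenedAbove T₀) : OffLineScreenedAbove T₁ :=
  fun ρ hρ hre h1 ↦ h ρ hρ hre (lt_of_le_of_lt hT h1)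

/-- A screened off-line zero contradicts `B′([−1,1])`. -/
theorem not_boundedAway_of_screenedAbove {T₀ : ℝ} (h : OffLineScreenedAbove T₀) {ρ : ℂ}
    (hρ : ρ ∈ ZetaZeros.riemannZetaNontrivialZeros) (hre : 1 / 2 < ρ.re) (hT : T₀ < ρ.im) :
    ¬ TruncNegEigenvalueBoundedAway (Icc (-1 : ℝ) 1) := by
  rintro ⟨c, hc, N₀, hN₀⟩
  obtain ⟨N₁, hN₁⟩ := h ρ hρ hre hT c hc
  obtain ⟨μ, hμ, him, hlo, hneg⟩ := hN₁ (max N₀ N₁) (le_max_right _ _)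
  have := hN₀ (max N₀ N₁) (le_max_left _ _) μ hμ him hneg
  linarith

/-- RH gives RH up to every height (a zero with `Im s > 0` is neither trivial nor the pole). [folklore] -/
private theorem riemannHypothesisUpTo_of_rh (h : _root_.RiemannHypothesis) (T : ℝ) : RiemannHypothesisUpTo T := by
  intro s hs him _
  refine h s hs ?_ ?_
  · rintro ⟨n, hn⟩
    have := congrArg Complex.im hn
    simp at this
    linarith
  · intro h1
    rw [h1] at him
    simp at him

/-- From `¬RH` and `RH(T₀)`: a nontrivial zero RIGHT of the line ABOVE height `T₀` (conjugate to positive height, then mirror `ρ ↦ 1 − ρ̄`). -/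
theorem exists_offLine_above {T₀ : ℝ} (hup : RiemannHypothesisUpTo T₀) (hnot : ¬ _root_.RiemannHypothesis) :
    ∃ ρ ∈ ZetaZeros.riemannZetaNontrivialZeros, 1 / 2 < ρ.re ∧ T₀ < ρ.im := by
  obtain ⟨s, hs, htriv, h1, hre⟩ :
      ∃ s : ℂ, riemannZeta s = 0 ∧ (¬ ∃ n : ℕ, s = -2 * (n + 1)) ∧ s ≠ 1 ∧ s.re ≠ 1 / 2 := by
    by_contra hcon
    exact hnot fun s hs htriv h1 ↦ by_contra fun hre ↦ hcon ⟨s, hs, htriv, h1, hre⟩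
  have hmem : s ∈ ZetaZeros.riemannZetaNontrivialZeros := by
    refine ⟨hs, ?_⟩
    rintro ⟨k, hk⟩
    exact htriv ⟨k, hk.symm⟩
  have him_ne : s.im ≠ 0 := ZetaZeros.riemannZetaNontrivialZeros.im_ne_zero hmem
  obtain ⟨ρ₁, hρ₁, hre₁, him₁⟩ :
      ∃ ρ₁ ∈ ZetaZeros.riemannZetaNontrivialZeros, ρ₁.re = s.re ∧ ρ₁.im = |s.im| := by
    by_cases h0 : 0 ≤ s.im
    · exact ⟨s, hmem, rfl, (abs_of_nonneg h0).symm⟩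
    · exact ⟨conj s, ZetaZeros.riemannZetaNontrivialZeros.conj_mem hmem, by simp,
        by rw [Complex.conj_im, abs_of_neg (not_le.1 h0)]⟩
  have hpos : 0 < ρ₁.im := by rw [him₁]; exact abs_pos.2 him_ne
  have hT : T₀ < ρ₁.im := by
    by_contra hle
    have h' := hup ρ₁ (ZetaZeros.riemannZetaNontrivialZeros.zeta_eq_zero hρ₁) hpos (not_lt.1 hle)
    exact hre (by rw [← hre₁]; exact h')
  by_cases hside : 1 / 2 < ρ₁.re
  · exact ⟨ρ₁, hρ₁, hside, hT⟩
  · refine ⟨1 - conj ρ₁, ZeroIdx.one_sub_conj_mem hρ₁, ?_, by simpa using hT⟩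
    have hne : ρ₁.re ≠ 1 / 2 := by rw [hre₁]; exact hre
    have hlt : ρ₁.re < 1 / 2 := lt_of_le_of_ne (not_lt.1 hside) hne
    simp only [Complex.sub_re, Complex.one_re, Complex.conj_re]
    linarith

open Summit.RiemannHypothesis.RiemannHypothesis.Theorems.Splittings.BombieriCorollaryProvenance in
/-- **Row X-7:** `RH ⟺ RH(T₀) ∧ B′([−1,1])` modulo OFF-LINE SCREENING ABOVE `T₀`.  NO `Corollary11Prov`, NO simplicity / multiplicity
head, NO Littlewood: the finitely-many-off-line-zeros regime of row C5 is replaced by the VERIFIED HEIGHT `T₀`, and every off-line zero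
above `T₀` is screened by the zeros around it.  [new-combination; CONDITIONAL bookkeeping on the displayed hypothesis] -/
theorem rh_iff_rhUpTo_and_boundedAway {T₀ : ℝ} (h : OffLineScreenedAbove T₀) :
    _root_.RiemannHypothesis ↔ RiemannHypothesisUpTo T₀ ∧ TruncNegEigenvalueBoundedAway (Icc (-1 : ℝ) 1) := by
  refine ⟨fun hRH ↦ ⟨riemannHypothesisUpTo_of_rh hRH T₀, truncNegEigenvalueBoundedAway_Icc_of_rh hRH 1⟩, fun hAB ↦ ?_⟩
  by_contra hnot
  obtain ⟨ρ, hρ, hre, hT⟩ := exists_offLine_above hAB.1 hnot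
  exact not_boundedAway_of_screenedAbove h hρ hre hT hAB.2

/-- **Row X-7, the `A → (B ↔ RH)` reading:** given RH up to `T₀` and screening above `T₀`, Bombieri's question (c) on `[−1,1]` IS RH. -/
theorem boundedAway_iff_rh_of_rhUpTo {T₀ : ℝ} (h : OffLineScreenedAbove T₀) (hup : RiemannHypothesisUpTo T₀) :
    TruncNegEigenvalueBoundedAway (Icc (-1 : ℝ) 1) ↔ _root_.RiemannHypothesis :=
  ⟨fun hB ↦ (rh_iff_rhUpTo_and_boundedAway h).2 ⟨hup, hB⟩, fun hRH ↦ ((rh_iff_rhUpTo_and_boundedAway h).1 hRH).2⟩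

/-- **Row X-7/PT:** modulo the Platt–Trudgian numerical RH [print: Bull. LMS 53 (2021) Thm 1, a certified computation; tree named fact
`platt_trudgian_numerical_rh`] and OFF-LINE SCREENING above `H = 3 000 175 332 800`, `B′([−1,1]) ⟺ RH`.
[new-combination; CONDITIONAL bookkeeping — the screening hypothesis at THIS height needs the sampling constant of card §14b–e] -/
theorem boundedAway_iff_rh_of_plattTrudgian (hPT : platt_trudgian_numerical_rh)
    (h : OffLineScreenedAbove 3000175332800) :
    TruncNegEigenvalueBoundedAway (Icc (-1 : ℝ) 1) ↔ _root_.RiemannHypothesis :=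
  boundedAway_iff_rh_of_rhUpTo h fun s hs h0 hT ↦ hPT s hs h0 hT

/-- **The FOZ-free, fact-free kernel content of X-7:** screening above `T₀` and ONE off-line zero above `T₀` kill `B′([−1,1])`. -/
theorem not_boundedAway_of_screenedAbove_of_not_rh {T₀ : ℝ} (h : OffLineScreenedAbove T₀) (hup : RiemannHypothesisUpTo T₀)
    (hnot : ¬ _root_.RiemannHypothesis) : ¬ TruncNegEigenvalueBoundedAway (Icc (-1 : ℝ) 1) := by
  obtain ⟨ρ, hρ, hre, hT⟩ := exists_offLine_above hup hnot
  exact not_boundedAway_of_screenedAbove h hρ hre hT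

/-- `SynthesisScreening` (row X-6's paper theorem) is the special case «bounded off-line multiplicity» of the g8 mechanism; conversely
screening above ANY height gives it outright when RH holds up to that height. -/
theorem synthesisScreening_of_screenedAbove {T₀ : ℝ} (h : OffLineScreenedAbove T₀) (hup : RiemannHypothesisUpTo T₀) :
    SynthesisScreening := fun _ hnotfoz hB ↦ by
  have hnot : ¬ _root_.RiemannHypothesis := fun hRH ↦ hnotfoz (by
    rw [cofiniteCriticalLine_iff_foz]
    exact Set.Finite.subset (Set.finite_empty) fun ρ ⟨hρ, hne⟩ ↦ hne (by
      obtain ⟨hz, h0, h1⟩ := mem_riemannZetaNontrivialZeros_iff_holds.1 hρ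
      exact hRH ρ hz (by
        rintro ⟨n, hn⟩
        have := congrArg Complex.re hn
        simp at this
        linarith) (by
        intro h1'
        rw [h1'] at h1
        simp at h1)))
  exact not_boundedAway_of_screenedAbove_of_not_rh h hup hnot hB

/-! ### G8.4b FIXED-LEVEL variants: `B′` at level `c₀` and screening at level `c₀` (g8 late correction, card §14h)

Screening a FIXED off-line zero at EVERY level `c ↓ 0` needs helper windows of unbounded length (finite families have a residual floor),
on which the zeros of `ζ` do NOT have flat density; at ONE level `c₀` bounded windows suffice.  Since under RH the truncations have no
negative eigenvalue at all, `B′` may be replaced by its fixed-level form `B′_{c₀}` in the row at no cost. -/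

/-- `B′_{c₀}(E)`: Bombieri's question (c) at a FIXED level — eventually no real eigenvalue of `𝒦_E(Γ_N)` in `(−c₀, 0)`. [new; conjectural] -/
@[conjecture] def TruncNegEigenvalueBoundedAwayAt (E : Set ℝ) (c₀ : ℝ) : Prop :=
  ∃ N₀ : ℕ, ∀ N : ℕ, N₀ ≤ N → ∀ μ : ℂ, μ ∈ (truncKMat E N).charpoly.roots → μ.im = 0 → μ.re < 0 → μ.re ≤ -c₀

/-- A fixed positive level `c₀` for `B′_{c₀}(E)` witnesses `B′(E)`. -/
theorem boundedAway_of_boundedAwayAt {E : Set ℝ} {c₀ : ℝ} (hc₀ : 0 < c₀) (h : TruncNegEigenvalueBoundedAwayAt E c₀) :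
    TruncNegEigenvalueBoundedAway E := ⟨c₀, hc₀, h⟩

open Summit.RiemannHypothesis.RiemannHypothesis.Theorems.Splittings.BombieriCorollaryProvenance in
/-- `RH ⟹ B′_{c₀}([−a, a])` at every level: under RH the truncations are Gram matrices of real-frequency exponentials. [folklore] -/
theorem boundedAwayAt_of_rh (hRH : _root_.RiemannHypothesis) (a c₀ : ℝ) :
    TruncNegEigenvalueBoundedAwayAt (Icc (-a) a) c₀ := by
  refine ⟨0, fun N _ μ hμ _ hneg ↦ ?_⟩
  have hmat : truncKMat (Icc (-a) a) N = KMat (Icc (-a) a) (fun i : truncIdx N ↦ ((((i : ZeroIdx).val.im : ℝ)) : ℂ)) := by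
    ext i j
    simp [truncKMat, KMat, gamma_eq_im_of_rh hRH]
  rw [hmat] at hμ
  have h0 := re_nonneg_of_mem_roots_charpoly_KMat_real measure_Icc_lt_top.ne (fun i : truncIdx N ↦ (i : ZeroIdx).val.im) hμ
  linarith

/-- **OFF-LINE SCREENING ABOVE `T₀` AT LEVEL `c₀`**: every off-line zero right of the line above `T₀` eventually produces a real eigenvalue
of `𝒦_{[−1,1]}(Γ_N)` in `(−c₀, 0)`. [new; conjectural — the level-`1` case is the target of T8c below] -/
@[conjecture] def OffLineScreenedAboveAt (T₀ c₀ : ℝ) : Prop :=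
  ∀ ρ ∈ ZetaZeros.riemannZetaNontrivialZeros, 1 / 2 < ρ.re → T₀ < ρ.im →
    ∃ N₀ : ℕ, ∀ N : ℕ, N₀ ≤ N →
      ∃ μ ∈ (truncKMat (Icc (-1 : ℝ) 1) N).charpoly.roots, μ.im = 0 ∧ -c₀ < μ.re ∧ μ.re < 0

/-- Screening at every level gives screening at the fixed level `c₀ > 0`. -/
theorem offLineScreenedAboveAt_of_all {T₀ c₀ : ℝ} (hc₀ : 0 < c₀) (h : OffLineScreenedAbove T₀) :
    OffLineScreenedAboveAt T₀ c₀ := fun ρ hρ hre hT ↦ h ρ hρ hre hT c₀ hc₀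

/-- An off-line zero right of the line above `T₀`, screened at level `c₀`, refutes `B′_{c₀}([−1,1])`. -/
theorem not_boundedAwayAt_of_screenedAboveAt {T₀ c₀ : ℝ} (h : OffLineScreenedAboveAt T₀ c₀) {ρ : ℂ}
    (hρ : ρ ∈ ZetaZeros.riemannZetaNontrivialZeros) (hre : 1 / 2 < ρ.re) (hT : T₀ < ρ.im) :
    ¬ TruncNegEigenvalueBoundedAwayAt (Icc (-1 : ℝ) 1) c₀ := by
  rintro ⟨N₀, hN₀⟩
  obtain ⟨N₁, hN₁⟩ := h ρ hρ hre hT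
  obtain ⟨μ, hμ, him, hlo, hneg⟩ := hN₁ (max N₀ N₁) (le_max_right _ _)
  have := hN₀ (max N₀ N₁) (le_max_left _ _) μ hμ him hneg
  linarith

/-- **Row X-7₁ (fixed level):** modulo screening above `T₀` at level `c₀`, `RH ⟺ RH(T₀) ∧ B′_{c₀}([−1,1])`. [new; conditional bookkeeping] -/
theorem rh_iff_rhUpTo_and_boundedAwayAt {T₀ c₀ : ℝ} (h : OffLineScreenedAboveAt T₀ c₀) :
    _root_.RiemannHypothesis ↔ RiemannHypothesisUpTo T₀ ∧ TruncNegEigenvalueBoundedAwayAt (Icc (-1 : ℝ) 1) c₀ := by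
  refine ⟨fun hRH ↦ ⟨riemannHypothesisUpTo_of_rh hRH T₀, boundedAwayAt_of_rh hRH 1 c₀⟩, fun hAB ↦ ?_⟩
  by_contra hnot
  obtain ⟨ρ, hρ, hre, hT⟩ := exists_offLine_above hAB.1 hnot
  exact not_boundedAwayAt_of_screenedAboveAt h hρ hre hT hAB.2

/-- **Row X-7₁/PT:** modulo Platt–Trudgian and screening at level `c₀` above `H = 3 000 175 332 800`, `B′_{c₀}([−1,1]) ⟺ RH`. -/
theorem boundedAwayAt_iff_rh_of_plattTrudgian (hPT : platt_trudgian_numerical_rh) {c₀ : ℝ}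
    (h : OffLineScreenedAboveAt 3000175332800 c₀) :
    TruncNegEigenvalueBoundedAwayAt (Icc (-1 : ℝ) 1) c₀ ↔ _root_.RiemannHypothesis :=
  ⟨fun hB ↦ (rh_iff_rhUpTo_and_boundedAwayAt h).2 ⟨fun s hs h0 hT ↦ hPT s hs h0 hT, hB⟩,
    fun hRH ↦ ((rh_iff_rhUpTo_and_boundedAwayAt h).1 hRH).2⟩

end Summit.RiemannHypothesis.RiemannHypothesis.Theorems.Splittings.BombieriTruncMassAware
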